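import Summits.Ventures.HSemireg.WedgeHankelConfluent

/-!
# Venture HSemireg — THE CONFLUENT KERNEL LAW at the node `∞`: a class supported on the TOP window `[n − P, n]` with `q_{n−P} ≠ 0`
# (an order-`(P+1)` node at infinity: the point `δ_n`, the point plus its tangent, …) has kernel `SI_k ⊕ (forms with more than P y-letters)`, `k ≤ n − P`

HONEST FRAMING. Part of the Lean index of the computation cell `pub-hsemireg` (seat p10 gen 15, Sunday typer «UNIFORM-IN-n»).
Finite-dimensional EXTERIOR ALGEBRA over a field ONLY: no variety, no cohomology theory, no sheaf, no Ext group, no semiregularity map;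
nothing here says that HC / HC_CM / HC_AV holds; no Literature fact is declared or used.  Custodian versions as in `WedgeHankelSiegelIdeal`
(1/3) and `WedgeHankelConfluent`; the dictionary (`Θ^p/p! ↦ E_p = w_n(δ_p)`, the point `↦ δ_n ↦ E_n = y_0 ∧ ⋯ ∧ y_{n−1}`; `plane(a,b) ↔ H^b(⋀^a T)`;
`⌟v` ↦ `θ ↦ θ ∧ w_n(q)`) is QUOTED, never asserted.

WHAT IS IN THE TREE / KEYED.  `WedgeHankelConfluent` (gen 15): for `q` supported on `[0, P]` with `q_P ≠ 0` and `k + P ≤ n`, `Kr(univ, w_n(q), k) =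
SI_k ⊔ xRich(k, P)`.  Gen 13/14 treat the node at infinity (the point class `c·E_n`, kernel = the frame ideal `F_∞(k) = Σ_a y_a ∧ ⋀^{k−1}`) and the
point plus exponentials.  THIS FILE is the MIRROR of `WedgeHankelConfluent` under `x ↔ y` (proved directly, by the same induction on the
`y`-letter count — no automorphism is constructed):
* §21 `yRich n k P := Σ_{P < b ≤ k} plane(k−b, b)` — the degree-`k` forms with MORE THAN `P` `y`-letters (dictionary: `⊕_{b > P} H^b(⋀^{k−b} T)`); they kill
  every class supported on `[n − P, n]` (`mul_w_eq_zero_of_mem_yRich`: zero windows).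
* §22 **THE INDUCTION `prjY_mem_siegelIdeal_of_mul_w_eq_zero`**: `q_j = 0` for `j < n − P`, `q_{n−P} ≠ 0`, `k + P ≤ n`, `θ ∧ w_n(q) = 0` ⇒ every component
  `prj (k−b) b θ` with `b ≤ P` lies in `SI_k` (project onto the plane `(k − b + P, b + n − P)`; 691's block law at the window entry `δ_{n−P}`).
* §23 **THE CONFLUENT KERNEL LAW AT `∞`: `Kr_w_eq_of_order_top`: `Kr(univ, w_n(q), k) = SI_k ⊔ yRich(k, P)`** for every such `q`, `k ≤ n − P`; it depends
  only on `P` (`Kr_w_eq_Kr_w_of_order_top`), equals the kernel of the power `E_{n−P}` (`Kr_w_eq_Kr_spike_top`), is the generic `SI_k` for `P ≥ k`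
  (`Kr_w_eq_siegelIdeal_of_le_top`); **THE POINT `P = 0`: `Kr(univ, w_n(c·δ_n), k) = SI_k ⊔ yRich(k, 0) = yRich(k, 0)`** (`Kr_w_point'`,
  `siegelIdeal_le_yRich_zero`, **`Kr_w_point_eq_yRich`**: exactly the forms with a `y`-letter — gen 13's `F_∞(k)`, recovered) and **THE POINT WITH ITS TANGENT `P = 1`** (`Kr_w_point_tangent`: `q = (…, 0, B, A)` with `B ≠ 0`,
  `k + 1 ≤ n`: kernel `SI_k ⊔ yRich(k, 1)`, independent of `A`).
NOT typed here: nodes `λ ∈ K` other than `0` (frame change), several nodes, degrees `k > n − P`; anything Ext-side.  Class side only.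
-/

open Module

namespace Summit.Ventures.HSemireg.Wedge.HankelSiegelIdeal

open Summit.Ventures.HSemireg.Wedge Summit.Ventures.HSemireg.Wedge.Hankel
  Summit.Ventures.HSemireg.Wedge.HankelSiegel Summit.Ventures.HSemireg.Wedge.KunnethKernel

variable (K : Type*) [Field K] {n : ℕ}

/-! ## §21. The forms with more than `P` `y`-letters -/

/-- **`yRich n k P := Σ_{P < b ≤ k} plane(k − b, b)`**: the degree-`k` forms all of whose monomials have MORE THAN `P` `y`-letters
(dictionary: `⊕_{b > P} H^b(⋀^{k−b} T)`). -/
noncomputable def yRich (n k P : ℕ) : Submodule K (HT K (In n)) := ⨆ b ∈ Finset.Ioc P k, plane K n (k - b) b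

/-- `yRich ⊆ ⋀^k`. -/
theorem yRich_le_exteriorPower (k P : ℕ) : yRich K n k P ≤ ⋀[K]^k (In n → K) := by
  refine iSup₂_le fun b hb => ?_
  rw [Finset.mem_Ioc] at hb
  have := plane_le_exteriorPower K (n := n) (k - b) b
  rwa [show (k - b) + b = k by omega] at this

/-- a plane with more than `P` `y`-letters lies in `yRich`. -/
lemma plane_le_yRich {k P b : ℕ} (hb : P < b) (hbk : b ≤ k) : plane K n (k - b) b ≤ yRich K n k P :=
  le_iSup₂_of_le (f := fun b _ => plane K n (k - b) b) b (Finset.mem_Ioc.mpr ⟨hb, hbk⟩) le_rfl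

/-- forms with more than `P` `y`-letters kill every class supported on `[n − P, n]` (`k ≤ n`), submodule form. -/
theorem yRich_le_ker_mulRight {k P : ℕ} (hk : k ≤ n) {q : ℕ → K} (hq : ∀ j, j < n - P → q j = 0) :
    yRich K n k P ≤ LinearMap.ker (LinearMap.mulRight K (w K n n q)) := by
  refine iSup₂_le fun b hb => fun x hx => ?_
  rw [Finset.mem_Ioc] at hb
  rw [LinearMap.mem_ker, LinearMap.mulRight_apply]
  exact plane_mul_w_eq_zero_of_window K (by omega) (fun s hs => hq _ (by omega)) hx

/-- **FORMS WITH MORE THAN `P` `y`-LETTERS KILL EVERY CLASS SUPPORTED ON `[n − P, n]`** (`k ≤ n`): all their windows vanish. -/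
theorem mul_w_eq_zero_of_mem_yRich {k P : ℕ} (hk : k ≤ n) {q : ℕ → K} (hq : ∀ j, j < n - P → q j = 0) {θ : HT K (In n)}
    (hθ : θ ∈ yRich K n k P) : θ * w K n n q = 0 := by
  have h := yRich_le_ker_mulRight K hk hq hθ
  rwa [LinearMap.mem_ker, LinearMap.mulRight_apply] at h

/-- **`SI_k ⊔ yRich(k, P)` kills every class supported on `[n − P, n]`** (`k ≤ n`). -/
theorem mul_w_eq_zero_of_mem_sup_top {k P : ℕ} (hk : k ≤ n) {q : ℕ → K} (hq : ∀ j, j < n - P → q j = 0) {θ : HT K (In n)}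
    (hθ : θ ∈ siegelIdeal K n k ⊔ yRich K n k P) : θ * w K n n q = 0 := by
  obtain ⟨y, hy, z, hz, rfl⟩ := Submodule.mem_sup.mp hθ
  rw [add_mul, mul_w_eq_zero_of_mem_siegelIdeal K hy q, mul_w_eq_zero_of_mem_yRich K hk hq hz, add_zero]

/-! ## §22. The induction on the number of `y`-letters -/

/-- expansion of `θ ∧ w_n(q)` over the components of `θ ∈ ⋀^k` and ALL the powers `E_p`, `p ≤ n`. -/
lemma mul_w_eq_sum_sum_top {k : ℕ} (q : ℕ → K) {θ : HT K (In n)} (hθ : θ ∈ ⋀[K]^k (In n → K)) :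
    θ * w K n n q = ∑ e ∈ Finset.range (k + 1), ∑ p ∈ Finset.range (n + 1),
      q p • (prj K n e (k - e) θ * w K n n (fun j => if j = p then (1 : K) else 0)) := by
  conv_lhs => rw [← sum_prj K hθ, w_eq_sum_spikes K q, Finset.sum_mul]
  refine Finset.sum_congr rfl fun e _ => ?_
  rw [Finset.mul_sum]
  refine Finset.sum_congr rfl fun p _ => ?_
  rw [mul_smul_comm]

/-- **THE INDUCTION AT `∞`**: `q_j = 0` for `j < n − P`, `q_{n−P} ≠ 0`, `k + P ≤ n`, `θ ∈ ⋀^k`, `θ ∧ w_n(q) = 0` ⇒ every component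
`prj (k−b) b θ` with `b ≤ P` (few `y`-letters) lies in `SI_k`. -/
theorem prjY_mem_siegelIdeal_of_mul_w_eq_zero {k P : ℕ} (hkP : k + P ≤ n) {q : ℕ → K} (hq : ∀ j, j < n - P → q j = 0)
    (hqP : q (n - P) ≠ 0) {θ : HT K (In n)} (hθ : θ ∈ ⋀[K]^k (In n → K)) (h0 : θ * w K n n q = 0) :
    ∀ b, b ≤ P → prj K n (k - b) b θ ∈ siegelIdeal K n k := by
  intro b
  induction b using Nat.strong_induction_on with
  | _ b IH =>
  intro hbP
  by_cases hbk : b ≤ k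
  swap
  · rw [prj_eq_zero_of_ne K (by omega) hθ]; exact Submodule.zero_mem _
  have hexp := mul_w_eq_sum_sum_top K q hθ (k := k)
  rw [h0] at hexp
  -- project onto the plane of the pair (component (k−b, b), power E_{n−P}): (k − b + P, b + (n − P))
  have hp := congrArg (prj K n (k - b + (n - (n - P))) (k - (k - b) + (n - P))) hexp
  rw [map_zero, map_sum, Finset.sum_eq_single (k - b)] at hp
  · rw [map_sum, Finset.sum_eq_single (n - P)] at hp
    · rw [map_smul, prj_of_mem_plane K (mul_w_spike_mem_plane K (by omega) (prj_mem_plane K (k - b) (k - (k - b)) θ))] at hp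
      have hE : prj K n (k - b) (k - (k - b)) θ * w K n n (fun j => if j = n - P then (1 : K) else 0) = 0 :=
        (smul_eq_zero.mp hp.symm).resolve_left hqP
      rw [show k - (k - b) = b by omega] at hE
      have hker : (⟨prj K n (k - b) b θ, prj_mem_plane K (k - b) b θ⟩ : plane K n (k - b) b) ∈
          LinearMap.ker (wedgeP K n (k - b) b (fun j => if j = n - P then (1 : K) else 0)) := by
        rw [LinearMap.mem_ker, wedgeP, LinearMap.comp_apply, Submodule.subtype_apply, LinearMap.mulRight_apply]; exact hE
      rw [ker_wedgeP_of_window_ne K (s := n - P - (k - b)) (by omega) (by rw [if_pos (by omega)]; exact one_ne_zero),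
        Submodule.mem_comap, Submodule.subtype_apply, show (k - b) + b = k by omega] at hker
      exact hker
    · intro p hp' hpP
      rw [Finset.mem_range] at hp'
      rw [map_smul, prj_of_mem_plane_ne K (Or.inr (by omega))
        (mul_w_spike_mem_plane K (by omega) (prj_mem_plane K (k - b) (k - (k - b)) θ)), smul_zero]
    · intro h; exact absurd (Finset.mem_range.mpr (by omega)) h
  · intro e he hea
    rw [Finset.mem_range] at he
    rw [map_sum]
    refine Finset.sum_eq_zero fun p hp' => ?_
    rw [Finset.mem_range] at hp'
    rw [map_smul]
    by_cases hlow : p < n - P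
    · rw [hq p hlow, zero_smul]
    by_cases hmatch : (k - e) + p = b + (n - P)
    · -- then the component has fewer than b y-letters: isotropic by induction
      have hlt : k - e < b := by omega
      have hSI := IH (k - e) hlt (by omega)
      rw [show k - (k - e) = e by omega] at hSI
      rw [mul_w_eq_zero_of_mem_siegelIdeal K hSI, map_zero, smul_zero]
    · rw [prj_of_mem_plane_ne K (Or.inr (by omega)) (mul_w_spike_mem_plane K (by omega) (prj_mem_plane K e (k - e) θ)),
        smul_zero]
  · intro h; exact absurd (Finset.mem_range.mpr (by omega)) h

/-- hence such a `θ` lies in `SI_k ⊔ yRich(k, P)`. -/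
theorem mem_sup_top_of_mul_w_eq_zero {k P : ℕ} (hkP : k + P ≤ n) {q : ℕ → K} (hq : ∀ j, j < n - P → q j = 0)
    (hqP : q (n - P) ≠ 0) {θ : HT K (In n)} (hθ : θ ∈ ⋀[K]^k (In n → K)) (h0 : θ * w K n n q = 0) :
    θ ∈ siegelIdeal K n k ⊔ yRich K n k P := by
  rw [← sum_prj K hθ]
  refine Submodule.sum_mem _ fun e he => ?_
  rw [Finset.mem_range] at he
  by_cases hbP : k - e ≤ P
  · have h := prjY_mem_siegelIdeal_of_mul_w_eq_zero K hkP hq hqP hθ h0 (k - e) hbP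
    rw [show k - (k - e) = e by omega] at h
    exact Submodule.mem_sup_left h
  · have h := plane_le_yRich K (n := n) (k := k) (P := P) (b := k - e) (by omega) (by omega)
    rw [show k - (k - e) = e by omega] at h
    exact Submodule.mem_sup_right (h (prj_mem_plane K e (k - e) θ))

/-! ## §23. The confluent kernel law at the node at infinity -/

/-- **THE CONFLUENT KERNEL LAW AT `∞` (wedge form)**: for `q` supported on `[n − P, n]` with `q_{n−P} ≠ 0` and `k + P ≤ n`,
`ker(θ ↦ θ ∧ w_n(q) ∣ ⋀^k) = SI_k ⊔ yRich(k, P)`. -/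
theorem ker_wedge_w_eq_of_order_top {k P : ℕ} (hkP : k + P ≤ n) {q : ℕ → K} (hq : ∀ j, j < n - P → q j = 0) (hqP : q (n - P) ≠ 0) :
    LinearMap.ker (Hankel.wedge K n k (w K n n q)) = (siegelIdeal K n k ⊔ yRich K n k P).comap (⋀[K]^k (In n → K)).subtype := by
  ext θ
  rw [LinearMap.mem_ker, Submodule.mem_comap, Submodule.subtype_apply, Hankel.wedge, LinearMap.comp_apply,
    Submodule.subtype_apply, LinearMap.mulRight_apply]
  exact ⟨fun h => mem_sup_top_of_mul_w_eq_zero K hkP hq hqP θ.2 h, fun h => mul_w_eq_zero_of_mem_sup_top K (by omega) hq h⟩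

/-- **THE CONFLUENT KERNEL LAW AT `∞`: `Kr(univ, w_n(q), k) = SI_k ⊔ yRich(k, P)`** for `q` supported on `[n − P, n]`, `q_{n−P} ≠ 0`, `k + P ≤ n`. -/
theorem Kr_w_eq_of_order_top {k P : ℕ} (hkP : k + P ≤ n) {q : ℕ → K} (hq : ∀ j, j < n - P → q j = 0) (hqP : q (n - P) ≠ 0) :
    Kr K Finset.univ (w K n n q) k = siegelIdeal K n k ⊔ yRich K n k P := by
  ext θ
  rw [mem_Kr, KunnethKernel.Hom_univ_eq_exteriorPower]
  constructor
  · rintro ⟨hθ, h0⟩; exact mem_sup_top_of_mul_w_eq_zero K hkP hq hqP hθ h0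
  · intro h
    exact ⟨sup_le (siegelIdeal_le_exteriorPower K k) (yRich_le_exteriorPower K k P) h,
      mul_w_eq_zero_of_mem_sup_top K (by omega) hq h⟩

/-- **THE KERNEL DEPENDS ONLY ON THE ORDER AT `∞`**: two classes supported on `[n − P, n]` with `q_{n−P} ≠ 0` have the same kernels, `k ≤ n − P`. -/
theorem Kr_w_eq_Kr_w_of_order_top {k P : ℕ} (hkP : k + P ≤ n) {q q' : ℕ → K} (hq : ∀ j, j < n - P → q j = 0)
    (hqP : q (n - P) ≠ 0) (hq' : ∀ j, j < n - P → q' j = 0) (hqP' : q' (n - P) ≠ 0) :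
    Kr K Finset.univ (w K n n q) k = Kr K Finset.univ (w K n n q') k := by
  rw [Kr_w_eq_of_order_top K hkP hq hqP, Kr_w_eq_of_order_top K hkP hq' hqP']

/-- **… in particular it is the kernel of the power `E_{n−P}`.** -/
theorem Kr_w_eq_Kr_spike_top {k P : ℕ} (hkP : k + P ≤ n) {q : ℕ → K} (hq : ∀ j, j < n - P → q j = 0) (hqP : q (n - P) ≠ 0) :
    Kr K Finset.univ (w K n n q) k = Kr K Finset.univ (w K n n (fun j => if j = n - P then (1 : K) else 0)) k :=
  Kr_w_eq_Kr_w_of_order_top K hkP hq hqP (fun j hj => if_neg (by omega)) (by rw [if_pos rfl]; exact one_ne_zero)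

/-- **ORDER AT LEAST THE DEGREE ⇒ THE GENERIC KERNEL** at `∞`: `P ≥ k` ⇒ `Kr = SI_k`. -/
theorem Kr_w_eq_siegelIdeal_of_le_top {k P : ℕ} (hkP : k + P ≤ n) (hPk : k ≤ P) {q : ℕ → K} (hq : ∀ j, j < n - P → q j = 0)
    (hqP : q (n - P) ≠ 0) : Kr K Finset.univ (w K n n q) k = siegelIdeal K n k := by
  rw [Kr_w_eq_of_order_top K hkP hq hqP, yRich, Finset.Ioc_eq_empty (by omega)]
  simp

/-- **THE POINT: `Kr(univ, w_n(c·δ_n), k) = SI_k ⊔ yRich(k, 0)`** for `c ≠ 0`, `k ≤ n` — the Siegel ideal plus every form with a `y`-letter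
(gen 13's frame ideal at infinity `F_∞(k)`, by value). -/
theorem Kr_w_point' {k : ℕ} (hk : k ≤ n) {c : K} (hc : c ≠ 0) :
    Kr K Finset.univ (w K n n (fun j => if j = n then c else 0)) k = siegelIdeal K n k ⊔ yRich K n k 0 :=
  Kr_w_eq_of_order_top K (P := 0) (by omega) (fun j hj => if_neg (by omega)) (by rw [Nat.sub_zero, if_pos rfl]; exact hc)

/-- **THE POINT WITH ITS TANGENT: `q = (0, …, 0, B, A)` (`q_{n−1} = B ≠ 0`, `q_n = A`), `k + 1 ≤ n`: kernel `SI_k ⊔ yRich(k, 1)`, independent of `A`.** -/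
theorem Kr_w_point_tangent {k : ℕ} (hk : k + 1 ≤ n) (A : K) {B : K} (hB : B ≠ 0) :
    Kr K Finset.univ (w K n n (fun j => if j = n then A else if j = n - 1 then B else 0)) k = siegelIdeal K n k ⊔ yRich K n k 1 :=
  Kr_w_eq_of_order_top K hk
    (fun j hj => by
      show (if j = n then A else if j = n - 1 then B else 0) = 0
      rw [if_neg (by omega), if_neg (by omega)])
    (by
      show (if n - 1 = n then A else if n - 1 = n - 1 then B else 0) ≠ 0
      rw [if_neg (by omega), if_pos rfl]; exact hB)

/-- **THE SIEGEL IDEAL HAS A `y`-LETTER EVERYWHERE: `SI_k ≤ yRich(k, 0)`.** -/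
theorem siegelIdeal_le_yRich_zero (k : ℕ) : siegelIdeal K n k ≤ yRich K n k 0 := by
  rw [siegelIdeal, Submodule.span_le]
  rintro _ ⟨p, rfl⟩
  have h := igen_mem_plane K p
  have hk : (Pof p.1.1).card + 1 + ((Qof p.1.1).card + 1) = k := by
    have := card_Pof_add_card_Qof p.1.1; have := p.1.2; omega
  rw [show (Pof p.1.1).card + 1 = k - ((Qof p.1.1).card + 1) by omega] at h
  exact plane_le_yRich K (by omega) (by omega) h

/-- **THE POINT, SHARP: `Kr(univ, w_n(c·δ_n), k) = yRich(k, 0)`** (`c ≠ 0`, `k ≤ n`) — exactly the forms with at least one `y`-letter: gen 13's frame ideal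
at infinity `F_∞(k)`, recovered from the confluent law. -/
theorem Kr_w_point_eq_yRich {k : ℕ} (hk : k ≤ n) {c : K} (hc : c ≠ 0) :
    Kr K Finset.univ (w K n n (fun j => if j = n then c else 0)) k = yRich K n k 0 := by
  rw [Kr_w_point' K hk hc, sup_eq_right]
  exact siegelIdeal_le_yRich_zero K k

end Summit.Ventures.HSemireg.Wedge.HankelSiegelIdeal
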